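import Summits.AtomisticToContinuum.HydrodynamicLimit.Theses.AntiMazurCoboundaries
import Summits.AtomisticToContinuum.HydrodynamicLimit.Theses.FluxGibbsianityLdDrude
import Summits.AtomisticToContinuum.HydrodynamicLimit.Theorems.AntiMazurCoboundariesKineticFluxLdDecaySelfTiltObjects
import Summits.AtomisticToContinuum.HydrodynamicLimit.Theorems.AntiMazurCoboundariesKineticFluxLdDecaySelfTiltIdentity
import Summits.AtomisticToContinuum.HydrodynamicLimit.Theorems.AntiMazurCoboundariesKineticFluxLdDecayQuadraticShadow
import Summits.AtomisticToContinuum.HydrodynamicLimit.Theorems.AntiMazurCoboundariesKineticFluxLdDecaySquareWindowMonotone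
import Summits.AtomisticToContinuum.HydrodynamicLimit.Theorems.AntiMazurCoboundariesKineticFluxLdDecayTiltedCumulantComparison
import HarnessLib

/-!
# Line `self-tilted-edge-covariance` — crux `KineticFluxLdDecay` (stmt-AtomisticToContinuum-10967)

LEAD SKELETON, re-seat a1 (prover-line-stmt-AtomisticToContinuum-10967-a1-0, 2026-08-17): delta vs the c2 tree copy — STUB 2
`stub_tiltedCumulantComparison` is now the LANDED theorem by name (p127630, `…Theorems.SelfTilt.stub_tiltedCumulantComparison`),
so the only `sorry`s left are the two OPEN stubs `stub_fastObservableMeanErgodic` (= item stmt-AtomisticToContinuum-10952 by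
name) and `stub_tiltedThirdCumulantSublinear` (crux-sized). Text below otherwise as c2.

c2 header: continuation c2 (prover-line-stmt-AtomisticToContinuum-10967-c2-0). Delta vs the c1 skeleton
(`Cruxes/KineticFluxLdDecay/Lines/self_tilted_edge_covariance.lean` @ 2026-08-16T20:23Z): the objects of the line
(`pathInt`, `tiltWeight`, `tiltMean`, `edgeCov`, `edgeCum`, `fejerInt`), the frame abbreviations and the statements of
the registered stubs are no longer re-declared here but IMPORTED from the landed objects module
`Theorems/AntiMazurCoboundariesKineticFluxLdDecaySelfTiltObjects.lean` (p124802, namespace `…Theorems.SelfTilt`), and the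
four landed stubs are the landed theorems BY NAME: `stub_selfTiltObjects` (p124802), `stub_selfTiltIdentity` (p126394),
`stub_quadraticShadow` (p126697), `stub_squareWindowMonotone` (p126810). Registered stub names and printed signatures
are unchanged. Open (sorried) stubs: `stub_fastObservableMeanErgodic` (= shared item stmt-AtomisticToContinuum-10952 BY NAME),
`stub_tiltedThirdCumulantSublinear` (OPEN, hardest, lead); `stub_tiltedCumulantComparison` LANDED p127630.

Skeleton (crux-plan, round 1) of the crux idea `Ideas/self-tilted-edge-covariance.md` (ideator 2; triage r1-1/2/3:
pass ×3). The crux is SHARED: `AntiMazurCoboundaries.KineticFluxLdDecay` (r4, payload route) and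
`FluxGibbsianityLdDrude.KineticFluxLdDecay` (r2) are the same term; the composition below concludes BOTH by name.

THE LEVER (exact, finite `N`, every flow). Write `J_u(z) = ∫₀ᵘ F(Φ_r z) dr` for the path integral of the crux's
one-body observable `F = Σᵢ φ(xᵢ) g(wᵢ)` and `μ^{β,u} ∝ e^{β J_u} μ` for the law SELF-TILTED over the forward window
`[0,u]` at rate `β` (`μ = G_N`, flow-invariant). Differentiating `log E_μ e^{β J_s}` ALONG THE WINDOW and using the
invariance of `μ` twice gives (`SelfTiltIdentity`, stub 1(i), LANDED):
  `log E_μ e^{β J_h} = β h E_μ F + β² ∫₀ʰ ∫₀ˢ 𝒞_β(u) du ds`,  `𝒞_β(u) := Cov_{μ^{β,u}}(F∘Φ_u, F)`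
and its quadratic shadow `E_μ (h⁻¹J_h)² = 2h⁻² ∫₀ʰ∫₀ˢ 𝒞_0(u) du ds + (E_μ F)²` (stub 1(ii), LANDED). The crux's
functional is the member `β = 1/h`; the L² shadow (`FastObservableMeanErgodic`, shared item 10952) is the member `β = 0`.

THE CRITERION. `∂_β 𝒞_β(u) = κ₃^{μ^{β,u}}(F∘Φ_u, F, J_u)` (joint third cumulant under the self-tilt), so by the mean
value theorem (`TiltedCumulantComparison`, stub 2, TRUE) `∫₀ʰ∫₀ˢ 𝒞_{1/h} ≤ ∫₀ʰ∫₀ˢ 𝒞_0 + h⁻¹ K h²/2` whenever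
`|κ₃^{μ^{β,u}}(F∘Φ_u, F, J_u)| ≤ K` on `u ≤ h`, `β ≤ 1/h`. Hence
  **10967 ⟸ 10952 ∧ [sup_{u ≤ h, β ≤ 1/h} (N+1)⁻¹ |κ₃^{μ^{β,u}}| = o(h) uniformly in N]**.
The L² input enters at its OWN window `τ₁` and is moved to the multiple `m τ₁ ≥ τ₀` by window monotonicity of the
quadratic functional (`SquareWindowMonotone`, stub 3, LANDED); the OPEN content is ONE object, the sublinear growth of
the self-tilted third cumulant for all large kinetic windows (`TiltedThirdCumulantSublinear`, stub 5, hardest), which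
is where the crux's amplitude clause `∃κ` and `⊥ v, |v|²` are consumed (Gibbs-tilt near-misses of `Disproof.lean` §3).

Composition (sorry-free): `exponent_bound` (real arithmetic) and `kineticFluxLdDecay_of_parts`
(`σ₀ := min`, `κ` from stub 5, L² tolerance `δ/4`, window `τ := m τ₁` with `m = ⌈τ₀/τ₁⌉₊ + 1`,
`N₀ := max N₁ (max N₅ ⌈2/δ⌉₊)`; for `μ = G_N`: probability from 10952's clause (A), invariance
`Theorems.measurePreserving_flow_localGibbsLaw_const` (PROVED), `G_N(goodᶜ) = 0` from
`localGibbsLaw_absolutelyContinuous`); `KineticFluxLdDecay_of : AntiMazurCoboundaries.KineticFluxLdDecay` and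
`KineticFluxLdDecay_of_sibling : FluxGibbsianityLdDrude.KineticFluxLdDecay` BY NAME from the registered stubs.
-/

noncomputable section

open MeasureTheory ProbabilityTheory Set Filter Topology
open scoped ENNReal

namespace Summit.AtomisticToContinuum.HydrodynamicLimit.Cruxes.KineticFluxLdDecay.SelfTiltedEdgeCovariance

open Literature.MathematicalPhysics.KineticTheory (T3 V3 hsDiameter localGibbsLaw)
open Literature.Analysis.FluidPDE (HardSphereFlow Config)
open Summit.AtomisticToContinuum.HydrodynamicLimit.Theorems.SelfTilt

/-! ## Registered stubs

The objects (`TFlow`, `TPhase`, `Flow`, `Phase`, `gibbs`, `fluxObs`, `window`, `Orthogonal`, `pathInt`, `tiltWeight`,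
`tiltMean`, `edgeCov`, `edgeCum`, `fejerInt`) and the stub statements (`SelfTiltObjectsBasic`, `SelfTiltIdentity`,
`QuadraticShadow`, `TiltedCumulantComparison`, `SquareWindowMonotone`, `TiltedThirdCumulantSublinear`) are those of the
landed objects module `…Theorems.SelfTilt` (opened above). -/

/-- STUB 0 (size S; bookkeeping) — LANDED p124802 as `Theorems.SelfTilt.stub_selfTiltObjects`: the tilt normalisation
`Z = E_μ e^{βJ_u}` obeys `e^{-|β||u|C} ≤ Z ≤ e^{|β||u|C}`. -/
theorem stub_selfTiltObjects : SelfTiltObjectsBasic :=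
  Summit.AtomisticToContinuum.HydrodynamicLimit.Theorems.SelfTilt.stub_selfTiltObjects

/-- STUB 1(i) (size L) — LANDED p126394 as `Theorems.SelfTilt.stub_selfTiltIdentity`: the self-tilted edge-covariance
identity `E_μ exp(βJ_h) = exp(βh E_μF + β² I_β(h))` for bounded continuous `F`, `Φ`-invariant `μ` carried by `good`. -/
theorem stub_selfTiltIdentity : SelfTiltIdentity :=
  Summit.AtomisticToContinuum.HydrodynamicLimit.Theorems.SelfTilt.stub_selfTiltIdentity

/-- STUB 1(ii) (size M) — LANDED p126697 as `Theorems.SelfTilt.stub_quadraticShadow`: `E_μ (h⁻¹J_h)² = 2h⁻²I_0(h) + (E_μF)²`. -/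
theorem stub_quadraticShadow : QuadraticShadow :=
  Summit.AtomisticToContinuum.HydrodynamicLimit.Theorems.SelfTilt.stub_quadraticShadow

/-- STUB 2 (size M) — LANDED p127630 as `Theorems.SelfTilt.stub_tiltedCumulantComparison` (dominated differentiation in the
tilt rate + MVT + interval-integral monotonicity). For `β ≥ 0`, `h > 0`, `K`: if `|κ₃^{μ^{β',u}}(F∘Φ_u, F, J_u)| ≤ K` for `u ∈ [0,h]`, `β' ∈ [0,β]`, then
`I_β(h) ≤ I_0(h) + βKh²/2`. Plan: `β' ↦ E_μ[X e^{β'J_u}]` is differentiable with derivative `E_μ[X J_u e^{β'J_u}]`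
(`hasDerivAt_integral_of_dominated_loc_of_deriv_le`; `X`, `J_u` bounded, a.e.-measurable), so
`∂_β tiltMean_β[X] = tiltMean[XJ_u] − tiltMean[X] tiltMean[J_u]` and `∂_β edgeCov = edgeCum` (joint-cumulant algebra);
MVT (`exists_hasDerivAt_eq_slope` / `Convex.norm_image_sub_le_of_norm_hasDerivWithin_le`) ⇒ `|𝒞_β(u) − 𝒞_0(u)| ≤ βK` on
`[0,h]`; integrate twice (`intervalIntegral.integral_mono_on` needs interval-integrability of `u ↦ edgeCov β u`: it is
bounded, and measurable in `u` by Fubini from `HardSphereFlow.measurable_flow_prod_torus`; alternatively bound the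
interval integrals through `norm_integral_le_of_norm_le_const`, which needs no integrability). Sources: DemboZeitouni2010
§2.3; triage r1-2 §E. -/
theorem stub_tiltedCumulantComparison : TiltedCumulantComparison :=
  Summit.AtomisticToContinuum.HydrodynamicLimit.Theorems.SelfTilt.stub_tiltedCumulantComparison

/-- STUB 3 (size M) — LANDED p126810 as `Theorems.SelfTilt.stub_squareWindowMonotone`: window monotonicity of the
quadratic functional, `E_μ ((mw)⁻¹ J_{mw})² ≤ E_μ (w⁻¹ J_w)²`. -/
theorem stub_squareWindowMonotone : SquareWindowMonotone :=
  Summit.AtomisticToContinuum.HydrodynamicLimit.Theorems.SelfTilt.stub_squareWindowMonotone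

/-- STUB 4 (size L; OPEN but strictly weaker in currency than the crux — THE SHARED SUPPORT ITEM
stmt-AtomisticToContinuum-10952 `FluxGibbsianityLdDrude.FastObservableMeanErgodic` BY NAME: uniform-in-`N` L² mean
ergodicity of fast one-body observables, the `β = 0` member of the identity; closing 10952 closes this stub).
Sources: LepriLiviPoliti2003 §8, Doyon2022 §5.1 Thm 5.1, Spohn1991 Part I Ch. 3; dilute-corner theorem-grade rung:
`AntiMazurCoboundaries.BoltzmannGreenKubo` (13985) after BodineauEtAl2024 Thm 1.2 / BGSSCPAM2023 Thm 1.1. This is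
where the line uses `⊥ 1` (`Disproof.kineticFluxLdDecay_false_without_orthogonality`: for `g ≡ κ` the raw second
moment is `κ²(N+1)²`) and `⊥ v, |v|²` at the L² level (Mazur bound by the conserved fields). -/
theorem stub_fastObservableMeanErgodic :
    Summit.AtomisticToContinuum.HydrodynamicLimit.Theses.FluxGibbsianityLdDrude.FastObservableMeanErgodic := by
  sorry

/-- STUB 5 (size XL; OPEN — the HARDEST, carries the LD-beyond-L² content of the crux: robustness of kinetic
decorrelation under weak extensive self-tilts, as ONE integrated third cumulant). Sources: OllaVaradhanYau1993 §3
(the functional); BGSSAnnals2023 (dynamical cumulant bounds over Lanford's time, arXiv:2008.10403 Thm 4);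
BodineauEtAl2024 Thm 1.2 / BGSSCPAM2023 Thm 1.1 (long-time covariance of the fluctuation field, Boltzmann–Grad);
Spohn1991 Part II §2.2; EvansMorriss2008 Ch. 7 (transient-time correlation functions); Disproof.lean §3 (why `∃κ`,
`⊥ v`, `⊥ |v|²` are load-bearing here). False iff a hidden extensive quasi-local charge overlapping `g` makes
`𝒞_{1/h}(u) ↛ 0` while `𝒞_0(u) → 0` (10967 false with 10952 true; MD falsifier (iv) of the card). First support
lemma (lead, this seat): Gibbs tilts are unprofitable at small amplitude (`tiltFunctional ≤ 0`, the positive reading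
of `Disproof.tiltFunctional_nonpos_of_admissible`). -/
theorem stub_tiltedThirdCumulantSublinear : TiltedThirdCumulantSublinear := by
  sorry

/-! ## Composition (sorry-free) -/

/-- **The exponent arithmetic of the criterion.** With `h > 0`, `x = N + 1 ≥ 2/δ`, mean `m = E F`, Fejér integrals
`I₀ = I_0(h)`, `I₁ = I_{1/h}(h)`: the L² input `2h⁻²I₀ + m² ≤ (δ/4)x` and the cumulant comparison
`I₁ ≤ I₀ + h⁻¹(δ h x)h²/2` give `h⁻¹h·m + h⁻²I₁ ≤ δx` (using `m − m²/2 ≤ ½ ≤ (3δ/8)x`). -/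
theorem exponent_bound {h δ x m I₀ I₁ : ℝ} (hh : 0 < h) (hδ : 0 < δ) (hx : 2 / δ ≤ x)
    (hq : 2 * h⁻¹ ^ 2 * I₀ + m ^ 2 ≤ δ / 4 * x)
    (hI : I₁ ≤ I₀ + h⁻¹ * (δ * h * x) * h ^ 2 / 2) :
    h⁻¹ * h * m + h⁻¹ ^ 2 * I₁ ≤ δ * x := by
  have hne : h ≠ 0 := hh.ne'
  have h1 : h⁻¹ * h = 1 := inv_mul_cancel₀ hne
  have hp : 0 ≤ h⁻¹ ^ 2 := by positivity
  have e : h⁻¹ ^ 2 * (I₀ + h⁻¹ * (δ * h * x) * h ^ 2 / 2) = h⁻¹ ^ 2 * I₀ + δ * x / 2 := by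
    field_simp
  have hI' : h⁻¹ ^ 2 * I₁ ≤ h⁻¹ ^ 2 * I₀ + δ * x / 2 := by
    have := mul_le_mul_of_nonneg_left hI hp
    rwa [e] at this
  have hδx : 2 ≤ δ * x := by
    have := (div_le_iff₀ hδ).1 hx
    linarith [mul_comm x δ]
  have hm : m ≤ (m ^ 2 + 1) / 2 := by nlinarith [sq_nonneg (m - 1)]
  rw [h1, one_mul]
  linarith

/-- Measurability of the crux's one-body observable (continuity; `Config` over the torus is a Borel space). -/
theorem measurable_fluxObs {θ : ℝ} {u₀ : V3} {φ : T3 → ℝ} {g : V3 → ℝ} (hφ : Continuous φ)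
    (hg : Continuous g) (N : ℕ) : Measurable (fluxObs θ u₀ φ g N) := by
  refine Continuous.measurable ?_
  unfold fluxObs
  fun_prop

/-- Continuity of the crux's one-body observable. -/
theorem continuous_fluxObs {θ : ℝ} {u₀ : V3} {φ : T3 → ℝ} {g : V3 → ℝ} (hφ : Continuous φ)
    (hg : Continuous g) (N : ℕ) : Continuous (fluxObs θ u₀ φ g N) := by
  unfold fluxObs
  fun_prop

/-- The crux's one-body observable is bounded by `(N+1)κ`. -/
theorem abs_fluxObs_le {θ κ : ℝ} {u₀ : V3} {φ : T3 → ℝ} {g : V3 → ℝ} (hφ1 : ∀ x, |φ x| ≤ 1)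
    (hgκ : ∀ v, |g v| ≤ κ) (N : ℕ) (z : Phase N) : |fluxObs θ u₀ φ g N z| ≤ (N + 1) * κ := by
  have hκ : 0 ≤ κ := (abs_nonneg _).trans (hgκ 0)
  calc |fluxObs θ u₀ φ g N z|
      ≤ ∑ i, |φ (z i).1 * g ((Real.sqrt θ)⁻¹ • ((z i).2 - u₀))| := Finset.abs_sum_le_sum_abs _ _
    _ ≤ ∑ _i : Fin (N + 1), κ := by
        refine Finset.sum_le_sum fun i _ => ?_
        rw [abs_mul]
        calc |φ (z i).1| * |g ((Real.sqrt θ)⁻¹ • ((z i).2 - u₀))|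
            ≤ 1 * κ := mul_le_mul (hφ1 _) (hgκ _) (abs_nonneg _) zero_le_one
          _ = κ := one_mul κ
    _ = (N + 1) * κ := by simp

/-- The global Gibbs law is carried by the good set of the flow (it is absolutely continuous w.r.t. Liouville). -/
theorem gibbs_compl_good (σ a θ : ℝ) (u₀ : V3) (N : ℕ) (Φ : Flow σ N) :
    gibbs σ a θ u₀ N Φ Φ.goodᶜ = 0 :=
  Literature.MathematicalPhysics.KineticTheory.localGibbsLaw_absolutelyContinuous σ (fun _ => a) (fun _ => u₀)
    (fun _ => θ) N Φ Φ.measure_compl_good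

/-- **Composition of the line** (proved): the six stub statements imply the crux body (spelled with the
reducible frame abbreviations; `KineticFluxLdDecay_of` below restates it BY NAME). Choices: `σ₀ := min σ₄ σ₅`
(10952's and stub 5's), `κ` from stub 5, L² tolerance `δ/4` at its own window `τ₁`, cumulant tolerance `δ` beyond
`τ₀`, window `τ := m τ₁`, `m = ⌈τ₀/τ₁⌉₊ + 1`, `N₀ := max N₁ (max N₅ ⌈2/δ⌉₊)`; then stub 1 (i) at `β = 1/h`, stub 2
with `K = δ h (N+1)` fed by stub 5, stub 1 (ii) + stub 3 + 10952 for `2h⁻²I₀ + m² ≤ (δ/4)(N+1)`, and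
`exponent_bound`. -/
theorem kineticFluxLdDecay_of_parts (h₁ : SelfTiltIdentity) (h₁' : QuadraticShadow)
    (h₂ : TiltedCumulantComparison) (h₃ : SquareWindowMonotone)
    (h₄ : Summit.AtomisticToContinuum.HydrodynamicLimit.Theses.FluxGibbsianityLdDrude.FastObservableMeanErgodic)
    (h₅ : TiltedThirdCumulantSublinear) :
    ∀ (a θ : ℝ) (u₀ : V3), 0 < a → 0 < θ → ∃ σ₀ : ℝ, 0 < σ₀ ∧ ∀ σ : ℝ, 0 < σ → σ < σ₀ →
      (∀ (N : ℕ) (Φ : Flow σ N), IsProbabilityMeasure (gibbs σ a θ u₀ N Φ)) ∧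
      ∃ κ : ℝ, 0 < κ ∧ ∀ (φ : T3 → ℝ) (g : V3 → ℝ), Continuous φ → Continuous g →
        (∀ x, |φ x| ≤ 1) → (∀ v, |g v| ≤ κ) → Orthogonal g →
        ∀ δ : ℝ, 0 < δ → ∃ τ : ℝ, 0 < τ ∧ ∃ N₀ : ℕ, ∀ N : ℕ, N₀ ≤ N → ∀ Φ : Flow σ N,
          ∫⁻ z, ENNReal.ofReal (Real.exp ((window τ N)⁻¹ * ∫ s in (0 : ℝ)..(window τ N),
            ∑ i, φ (Φ.flow s z i).1 * g ((Real.sqrt θ)⁻¹ • ((Φ.flow s z i).2 - u₀))))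
              ∂(gibbs σ a θ u₀ N Φ) ≤ ENNReal.ofReal (Real.exp (δ * (N + 1))) := by
  intro a θ u₀ ha hθ
  obtain ⟨σ₄, hσ₄, H₄⟩ := h₄ a θ u₀ ha hθ
  obtain ⟨σ₅, hσ₅, H₅⟩ := h₅ a θ u₀ ha hθ
  refine ⟨min σ₄ σ₅, lt_min hσ₄ hσ₅, fun σ hσ hσlt => ?_⟩
  obtain ⟨hA, G₄⟩ := H₄ σ hσ (lt_of_lt_of_le hσlt (min_le_left _ _))
  obtain ⟨κ, hκ, G₅⟩ := H₅ σ hσ (lt_of_lt_of_le hσlt (min_le_right _ _))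
  refine ⟨hA, κ, hκ, fun φ g hφ hg hφ1 hgκ horth δ hδ => ?_⟩
  -- the L² input (10952) at tolerance δ/4, at its own window τ₁
  obtain ⟨τ₁, hτ₁, N₁, K₁⟩ := G₄ φ g hφ hg ⟨κ, hgκ⟩ horth (δ / 4) (by positivity)
  -- the cumulant input at tolerance δ, for all windows beyond τ₀
  obtain ⟨τ₀, hτ₀, K₅⟩ := G₅ φ g hφ hg hφ1 hgκ horth δ hδ
  -- the window of the crux: the first integer multiple of τ₁ beyond τ₀
  obtain ⟨m, hm0, hmτ⟩ : ∃ m : ℕ, 0 < m ∧ τ₀ ≤ (m : ℝ) * τ₁ := by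
    refine ⟨⌈τ₀ / τ₁⌉₊ + 1, Nat.succ_pos _, ?_⟩
    have h1 : τ₀ / τ₁ ≤ (⌈τ₀ / τ₁⌉₊ : ℝ) := Nat.le_ceil _
    have h2 : τ₀ / τ₁ ≤ ((⌈τ₀ / τ₁⌉₊ + 1 : ℕ) : ℝ) := by push_cast; linarith
    calc τ₀ = τ₀ / τ₁ * τ₁ := (div_mul_cancel₀ τ₀ hτ₁.ne').symm
      _ ≤ ((⌈τ₀ / τ₁⌉₊ + 1 : ℕ) : ℝ) * τ₁ := mul_le_mul_of_nonneg_right h2 hτ₁.le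
  obtain ⟨N₅, K₅'⟩ := K₅ ((m : ℝ) * τ₁) hmτ
  have hmpos : (0 : ℝ) < m := by exact_mod_cast hm0
  refine ⟨(m : ℝ) * τ₁, by positivity, max N₁ (max N₅ ⌈2 / δ⌉₊), fun N hN Φ => ?_⟩
  have hN₁ : N₁ ≤ N := le_trans (le_max_left _ _) hN
  have hN₅ : N₅ ≤ N := le_trans ((le_max_left _ _).trans (le_max_right _ _)) hN
  have hNδ : ⌈2 / δ⌉₊ ≤ N := le_trans ((le_max_right _ _).trans (le_max_right _ _)) hN
  have hx : 2 / δ ≤ (N : ℝ) + 1 := by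
    have := Nat.ceil_le.1 hNδ
    linarith
  -- the frame facts for μ = G_N
  set μ : Measure (Phase N) := gibbs σ a θ u₀ N Φ with hμ
  haveI : IsProbabilityMeasure μ := hA N Φ
  have hinv : ∀ t, MeasurePreserving (Φ.flow t) μ μ := fun t => gibbs_invariant σ a θ u₀ N Φ t
  have hgood : μ Φ.goodᶜ = 0 := gibbs_compl_good σ a θ u₀ N Φ
  set F : Phase N → ℝ := fluxObs θ u₀ φ g N with hF
  have hFm : Measurable F := measurable_fluxObs hφ hg N
  have hFc : Continuous F := continuous_fluxObs hφ hg N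
  have hFb : ∃ C : ℝ, ∀ z, |F z| ≤ C := ⟨(N + 1) * κ, abs_fluxObs_le hφ1 hgκ N⟩
  -- the two windows
  set hw : ℝ := window ((m : ℝ) * τ₁) N with hhw
  have hℓ : (0 : ℝ) < ((N + 1 : ℕ) : ℝ) ^ (-(1 / 3 : ℝ)) := Real.rpow_pos_of_pos (by positivity) _
  have hpos : 0 < hw := mul_pos (by positivity) hℓ
  have hw₁pos : 0 < window τ₁ N := mul_pos hτ₁ hℓ
  have hmw : (m : ℝ) * window τ₁ N = hw := by
    rw [hhw]
    exact (mul_assoc _ _ _).symm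
  -- stub 1 (i) at β = 1/h and (ii); stub 2 fed by stub 5; stub 3 + 10952
  have e1 := h₁ _ _ Φ μ inferInstance hinv hgood F hFc hFb hw⁻¹ hw hpos
  have e2 := h₁' _ _ Φ μ inferInstance hinv hgood F hFm hFb hw hpos
  have c2 : fejerInt Φ μ F hw⁻¹ hw ≤ fejerInt Φ μ F 0 hw + hw⁻¹ * (δ * hw * ((N : ℝ) + 1)) * hw ^ 2 / 2 :=
    h₂ _ _ Φ μ inferInstance hinv hgood F hFm hFb hw⁻¹ hw (δ * hw * ((N : ℝ) + 1))
      (inv_nonneg.2 hpos.le) hpos (K₅' N hN₅ Φ)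
  have mono := h₃ _ _ Φ μ inferInstance hinv hgood F hFm hFb (window τ₁ N) m hw₁pos hm0
  rw [hmw] at mono
  have l2 : ∫⁻ z, ENNReal.ofReal (((window τ₁ N)⁻¹ * pathInt Φ F (window τ₁ N) z) ^ 2) ∂μ ≤
      ENNReal.ofReal (δ / 4 * ((N : ℝ) + 1)) := K₁ N hN₁ Φ
  have hq : ∫⁻ z, ENNReal.ofReal ((hw⁻¹ * pathInt Φ F hw z) ^ 2) ∂μ ≤
      ENNReal.ofReal (δ / 4 * ((N : ℝ) + 1)) := mono.trans l2
  rw [e2] at hq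
  have hq' : 2 * hw⁻¹ ^ 2 * fejerInt Φ μ F 0 hw + (∫ z, F z ∂μ) ^ 2 ≤ δ / 4 * ((N : ℝ) + 1) :=
    (ENNReal.ofReal_le_ofReal_iff (by positivity)).1 hq
  have bound := exponent_bound hpos hδ hx hq' c2
  -- conclude
  refine le_trans (le_of_eq e1) ?_
  exact ENNReal.ofReal_le_ofReal (Real.exp_le_exp.2 bound)

/-- **The skeleton concludes the crux BY NAME** (payload route `AntiMazurCoboundaries`, shared item
stmt-AtomisticToContinuum-10967) from the registered stubs. -/
theorem KineticFluxLdDecay_of :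
    Summit.AtomisticToContinuum.HydrodynamicLimit.Theses.AntiMazurCoboundaries.KineticFluxLdDecay :=
  kineticFluxLdDecay_of_parts stub_selfTiltIdentity stub_quadraticShadow stub_tiltedCumulantComparison
    stub_squareWindowMonotone stub_fastObservableMeanErgodic stub_tiltedThirdCumulantSublinear

/-- The same composition for the sibling route's decl (`FluxGibbsianityLdDrude`, r2; `rfl`-equal term). -/
theorem KineticFluxLdDecay_of_sibling :
    Summit.AtomisticToContinuum.HydrodynamicLimit.Theses.FluxGibbsianityLdDrude.KineticFluxLdDecay :=
  kineticFluxLdDecay_of_parts stub_selfTiltIdentity stub_quadraticShadow stub_tiltedCumulantComparison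
    stub_squareWindowMonotone stub_fastObservableMeanErgodic stub_tiltedThirdCumulantSublinear

end Summit.AtomisticToContinuum.HydrodynamicLimit.Cruxes.KineticFluxLdDecay.SelfTiltedEdgeCovariance

end
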